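import Literature.RingTheory.KTheory.MilnorKWittRingRatFuncAscent
import Literature.RingTheory.KTheory.MilnorKModTwoExamples
import Literature.RingTheory.KTheory.MilnorKWittRingDimIndex
import HarnessLib

/-!
# LEMMA 4.6 for finite fields: over a finite field of odd characteristic every `sₙ : kₙF → Iⁿ/Iⁿ⁺¹` is injective and
# `⋂ Iⁿ = 0` (indeed `I² = 0`); hence (COR. 5.2) the same for henselian discretely valued fields with finite residue
# field, and (COR. 5.8, LEMMA 4.5 for `𝔽_q(t)`) for the rational function field `𝔽_q(t)`
# (Milnor, *Algebraic K-theory and quadratic forms*, Invent. Math. 9 (1970), §§4–5)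

Family `hodge`, lane `lit-hodgefound` (foundations library; seat `lit-hodgefound-p27`, generation 42, row g42-#8);
topic `RingTheory/KTheory`.  Sequel of `MilnorKWittRingRatFuncAscent` (g42-#7: COR 5.8 `corollary_5_8`), of
`MilnorKWittRingResidueFieldAscent` (g42-#6: COR 5.2 `corollary_5_2_of_henselian`), of `MilnorKModTwoExamples` (g40:
`MilnorK.mod2_eq_zero_of_finite`, `kₙ𝔽_q = 0` for `n ≥ 2`), of `MilnorKStiefelWhitneyAugmentationPowers` (g40:
`sHom_zero_injective`, `sHom_one_injective`) and of `MilnorKWittRingDimIndex` (g40: `gen_eq_one_of_isSquare`).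
PROVED THEOREMS ONLY; no definition, no named fact, no instance, no notation, 0 `sorry`, net debt 0 (D-0026).

## The source, verbatim

J. Milnor, *Algebraic K-theory and quadratic forms*, Invent. Math. 9 (1970) 318–344 (held `paper:doi-10-1007-bf01425486`;
bib key `Milnor1970`), §4 (p0016 L21–L24): «**LEMMA 4.6.** Now suppose that F is a field such that k₂F has at most two
distinct elements. Then again the sₙ are bijective and ⋂ Iⁿ = 0. Notice that this includes the case of a finite, or
local, or real closed, or quadratically closed field; as well as any direct limit of such fields.»; §4 (p0015 L40–L41):
«**LEMMA 4.5.** If F is a global field, or a direct limit of global fields, then both questions have affirmative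
answers.»; §1 (p0004 L8–L12): «**EXAMPLE 1.5** (Steinberg). If the field is finite, then K₂F = 0. […] if q is odd,
then an easy counting argument shows that 1 is the sum of two quadratic nonresidues in F».

## What is formalised, and how the proofs differ from the printed ones

* §1 finite fields `F` of odd characteristic (`(2 : F) ≠ 0`): the counting argument of Example 1.5 in the form
  **`exists_sq_mul_add_sq_mul_eq_one`** (`l²a + m²b = 1` is solvable for all units `a`, `b`; Mathlib's
  `FiniteField.exists_root_sum_quadratic`), hence `(a) + (b) = (1) + (ab)` and
  **`gen_sub_one_mul_gen_sub_one_eq_zero`** (`((a) − (1))((b) − (1)) = 0`), **`fundIdeal_sq_eq_bot` (`I² = 0`)**,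
  `fundIdeal_pow_eq_bot`, **`iInf_pow_fundIdeal_eq_bot_of_finite`** (Question 4.4), and
  **`sHom_injective_of_finite`** (Question 4.3: `s₀`, `s₁` from Theorem 4.1 / Stiefel–Whitney, `sₙ`, `n ≥ 2`, because
  `kₙF = 0`), packaged as **`lemma_4_6_finite`**.  Milnor derives Lemma 4.6 from Kaplansky–Shaker's classification;
  for a finite field the universality of binary forms gives the sharper `I² = 0` directly.
* §2 **`lemma_4_6_henselian_of_finite_residueField`**: a henselian discretely valued field whose residue field is finite
  of odd characteristic (e.g. a non-dyadic local field, complete ⇒ henselian) has all `sₙ` injective and `⋂ Iⁿ = 0` —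
  Lemma 4.6's «local» case, here through COROLLARY 5.2 rather than Kaplansky–Shaker.
* §3 **`lemma_4_5_ratFunc_finite`**: for `F` finite of odd characteristic, `𝔽_q(t)` has all `sₙ` injective and
  `⋂ Iⁿ = 0` — LEMMA 4.5 for the global field `𝔽_q(t)`, here through COROLLARY 5.8 and §1 (all residue fields
  `κ_𝔭 ≅ 𝔽_q[t]/𝔭` are finite of the same characteristic: `finite_residueFieldAt` and g42-#1's
  `two_ne_zero_residueFieldAt`)
  rather than through Tate's computation of `k_*` of a global field.
* Not here: Lemma 4.6 in Milnor's generality (`|k₂F| ≤ 2`, Kaplansky–Shaker), Lemma 4.5 for number fields and general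
  global fields (Tate, Hasse–Minkowski), direct limits.

## References

* [Milnor1970] J. Milnor, *Algebraic K-theory and quadratic forms*, Invent. Math. 9 (1970) 318–344 — §4 Lemma 4.6
  (p0016 L21–L38), Lemma 4.5 (p0015 L40 – p0016 L20), Questions 4.3/4.4 (p0015 L29–L35); §1 Example 1.5 (p0004
  L8–L12); §5 Corollaries 5.2 (p0017 L26–L27) and 5.8 (p0022 L11–L14).

Provenance: lane `lit-hodgefound`, seat `lit-hodgefound-p27` gen 42 (agent `literature-prover-lit-hodgefound-p27-g42-0`),
row g42-#8.
-/

set_option autoImplicit false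

noncomputable section

namespace Literature.RingTheory.KTheory

open Function Polynomial IsDedekindDomain

namespace WittRing

/-! ### §1 Finite fields of odd characteristic: `I² = 0`, Questions 4.3 and 4.4 -/

section Finite

variable (F : Type*) [Field F]

/-- A finite field with `2 ≠ 0` has odd order. [cite: Milnor1970, §1 Example 1.5 «if q is odd» (p0004 L8–L12)] -/
theorem card_mod_two_eq_one [Fintype F] (h2 : (2 : F) ≠ 0) : Fintype.card F % 2 = 1 := by
  rcases Nat.mod_two_eq_zero_or_one (Fintype.card F) with h | h
  · exfalso
    apply h2
    have hc : ringChar F = 2 := FiniteField.even_card_iff_char_two.2 h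
    have h0 : ((ringChar F : ℕ) : F) = 0 := ringChar.Nat.cast_ringChar
    rw [hc, Nat.cast_ofNat] at h0
    exact h0
  · exact h

/-- `m²b = 1` makes the unit `b` a square. [folklore] -/
private theorem isSquare_of_sq_mul_eq_one {m : F} {b : Fˣ} (h : m ^ 2 * b = 1) : IsSquare b := by
  have hm : m ≠ 0 := by
    rintro rfl
    rw [zero_pow two_ne_zero, zero_mul] at h
    exact zero_ne_one h
  refine ⟨(Units.mk0 m hm)⁻¹, Units.ext ?_⟩
  rw [Units.val_mul, Units.val_inv_eq_inv_val, Units.val_mk0]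
  field_simp
  linear_combination h

variable [Finite F]

/-- **«an easy counting argument»: over a finite field of odd characteristic every binary form `aX² + bY²` represents
`1`** (`l²a + m²b = 1` is solvable). [cite: Milnor1970, §1 Example 1.5 «1 is the sum of two quadratic nonresidues» (p0004 L10–L11); §4 Lemma 4.6 «the case of a finite […] field» (p0016 L21–L24)] -/
theorem exists_sq_mul_add_sq_mul_eq_one (h2 : (2 : F) ≠ 0) (a b : Fˣ) : ∃ l m : F, l ^ 2 * a + m ^ 2 * b = 1 := by
  haveI := Fintype.ofFinite F
  have ha : (C (a : F) * X ^ 2).degree = 2 := by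
    rw [degree_C_mul_X_pow 2 a.ne_zero]; rfl
  have hb : (C (b : F) * X ^ 2 - 1).degree = 2 := by
    rw [degree_sub_eq_left_of_degree_lt] <;> rw [degree_C_mul_X_pow 2 b.ne_zero]
    · rfl
    · rw [degree_one]; decide
  obtain ⟨l, m, h⟩ := FiniteField.exists_root_sum_quadratic ha hb (card_mod_two_eq_one F h2)
  refine ⟨l, m, ?_⟩
  simp only [eval_sub, eval_mul, eval_C, eval_pow, eval_X, eval_one] at h
  linear_combination h

/-- **Over a finite field of odd characteristic `((a) − (1))·((b) − (1)) = 0` in `W(F)`** (from `(a) + (b) = (1) + (ab)`,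
the relation `l²a + m²b = 1`). [cite: Milnor1970, §4 Lemma 4.6 «the case of a finite […] field» (p0016 L21–L24); §1 Example 1.5 (p0004 L8–L12)] -/
theorem gen_sub_one_mul_gen_sub_one_eq_zero (h2 : (2 : F) ≠ 0) (a b : Fˣ) : (gen F a - 1) * (gen F b - 1) = 0 := by
  obtain ⟨l, m, h⟩ := exists_sq_mul_add_sq_mul_eq_one F h2 a b
  by_cases hl : l = 0
  · rw [hl, zero_pow two_ne_zero, zero_mul, zero_add] at h
    rw [gen_eq_one_of_isSquare F (isSquare_of_sq_mul_eq_one F h), sub_self, mul_zero]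
  by_cases hm : m = 0
  · rw [hm, zero_pow two_ne_zero, zero_mul, add_zero] at h
    rw [gen_eq_one_of_isSquare F (isSquare_of_sq_mul_eq_one F h), sub_self, zero_mul]
  have hrel := gen_add_gen F (a := a) (b := b) (l := Units.mk0 l hl) (m := Units.mk0 m hm) (c := 1)
    (by rw [Units.val_mk0, Units.val_mk0, Units.val_one, h])
  rw [mul_one, gen_one, gen_mul] at hrel
  linear_combination (-1 : WittRing F) * hrel

/-- **`I² = 0` over a finite field of odd characteristic.** [cite: Milnor1970, §4 Lemma 4.6 (p0016 L21–L24)] -/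
theorem fundIdeal_sq_eq_bot (h2 : (2 : F) ≠ 0) : fundIdeal F ^ 2 = ⊥ := by
  rw [pow_two, fundIdeal, Ideal.span_mul_span']
  refine Ideal.span_eq_bot.2 ?_
  rintro _ ⟨_, ⟨a, rfl⟩, _, ⟨b, rfl⟩, rfl⟩
  exact gen_sub_one_mul_gen_sub_one_eq_zero F h2 a b

/-- `Iⁿ = 0` for `n ≥ 2` over a finite field of odd characteristic. [cite: Milnor1970, §4 Lemma 4.6 (p0016 L21–L24)] -/
theorem fundIdeal_pow_eq_bot (h2 : (2 : F) ≠ 0) {n : ℕ} (hn : 2 ≤ n) : fundIdeal F ^ n = ⊥ := by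
  obtain ⟨k, rfl⟩ := Nat.exists_eq_add_of_le hn
  rw [pow_add, fundIdeal_sq_eq_bot F h2, Ideal.bot_mul]

/-- **LEMMA 4.6, Question 4.4 for a finite field: `⋂ Iⁿ = 0`.** [cite: Milnor1970, §4 Lemma 4.6 «⋂ Iⁿ = 0 […] the case of a finite […] field» (p0016 L21–L24)] -/
theorem iInf_pow_fundIdeal_eq_bot_of_finite (h2 : (2 : F) ≠ 0) : (⨅ n : ℕ, fundIdeal F ^ n) = ⊥ :=
  eq_bot_iff.2 ((iInf_le _ 2).trans (fundIdeal_sq_eq_bot F h2).le)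

/-- **LEMMA 4.6, Question 4.3 for a finite field: every `sₙ` is injective** (`s₀`, `s₁` for any field with `2 ≠ 0`;
`kₙF = 0` for `n ≥ 2`). [cite: Milnor1970, §4 Lemma 4.6 «the sₙ are bijective […] the case of a finite […] field» (p0016 L21–L24); §1 Example 1.5 (p0004 L8–L12)] -/
theorem sHom_injective_of_finite (h2 : (2 : F) ≠ 0) (n : ℕ) : Injective (sHom F n) := by
  match n with
  | 0 => exact sHom_zero_injective F
  | 1 => exact sHom_one_injective F h2
  | n + 2 => exact fun x y _ => by rw [MilnorK.mod2_eq_zero_of_finite x, MilnorK.mod2_eq_zero_of_finite y]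

/-- **LEMMA 4.6 for a finite field of odd characteristic: both Questions 4.3 and 4.4 have affirmative answers.**
[cite: Milnor1970, §4 Lemma 4.6 (p0016 L21–L24)] -/
theorem lemma_4_6_finite (h2 : (2 : F) ≠ 0) :
    (∀ n, Injective (sHom F n)) ∧ (⨅ n : ℕ, fundIdeal F ^ n) = ⊥ :=
  ⟨sHom_injective_of_finite F h2, iInf_pow_fundIdeal_eq_bot_of_finite F h2⟩

end Finite

/-! ### §2 Henselian discretely valued fields with finite residue field (the «local» case of Lemma 4.6) -/

/-- **LEMMA 4.6, the local case, through COROLLARY 5.2: a henselian discretely valued field with finite residue field of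
odd characteristic has all `sₙ` injective and `⋂ Iⁿ = 0`.** [cite: Milnor1970, §4 Lemma 4.6 «the case of a […] local […] field» (p0016 L21–L24); §5 Corollary 5.2 (p0017 L26–L27)] -/
theorem lemma_4_6_henselian_of_finite_residueField {E : Type*} [Field E]
    (v : Valuation E (WithZero (Multiplicative ℤ))) {π : Eˣ} (hπ : addVal v π = 1)
    [HenselianLocalRing v.valuationSubring] [Finite (ValResidueField v)] (h2 : (2 : ValResidueField v) ≠ 0) :
    (∀ n, Injective (sHom E n)) ∧ (⨅ n : ℕ, fundIdeal E ^ n) = ⊥ :=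
  corollary_5_2_of_henselian v hπ h2 (sHom_injective_of_finite _ h2) (iInf_pow_fundIdeal_eq_bot_of_finite _ h2)

/-! ### §3 The rational function field over a finite field (Lemma 4.5 for `𝔽_q(t)`, through Corollary 5.8) -/

section RatFunc

variable (F : Type*) [Field F]

/-- The residue fields `κ_𝔭 ≅ F[t]/𝔭` of `F(t)` over a finite field are finite. [cite: Milnor1970, §5 Corollary 5.8 «every finite extension F′ of a field F» (p0022 L11–L13)] -/
theorem finite_residueFieldAt [Finite F] (v : HeightOneSpectrum F[X]) : Finite (ResidueFieldAt F[X] (RatFunc F) v) := by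
  have h1 : Module.Finite F (F[X] ⧸ v.asIdeal) := by
    rw [← span_monicGen F v]; exact (monic_monicGen F v).finite_quotient
  have h2 : Finite (F[X] ⧸ v.asIdeal) := Module.finite_of_finite F
  exact Finite.of_equiv _ (quotientEquivResidueFieldAt F[X] (RatFunc F) v).toEquiv

/-- **LEMMA 4.5 for the global field `𝔽_q(t)`, `q` odd — through COROLLARY 5.8 and Lemma 4.6 for the finite fields `𝔽_q`
and `𝔽_q[t]/𝔭`: every `sₙ : kₙ𝔽_q(t) → Iⁿ/Iⁿ⁺¹` is injective and `⋂ Iⁿ𝔽_q(t) = 0`.** [cite: Milnor1970, §4 Lemma 4.5 «If F is a global field […] both questions have affirmative answers» (p0015 L40–L41); §5 Corollary 5.8 (p0022 L11–L14); §4 Lemma 4.6 (p0016 L21–L24)] -/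
theorem lemma_4_5_ratFunc_finite [Finite F] (h2 : (2 : F) ≠ 0) :
    (∀ n, Injective (sHom (RatFunc F) n)) ∧ (⨅ n : ℕ, fundIdeal (RatFunc F) ^ n) = ⊥ :=
  corollary_5_8 F h2 (sHom_injective_of_finite F h2) (iInf_pow_fundIdeal_eq_bot_of_finite F h2)
    (fun v n => by
      haveI := finite_residueFieldAt F v
      exact sHom_injective_of_finite _ (two_ne_zero_residueFieldAt v h2) n)
    (fun v => by
      haveI := finite_residueFieldAt F v
      exact iInf_pow_fundIdeal_eq_bot_of_finite _ (two_ne_zero_residueFieldAt v h2))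

end RatFunc

end WittRing

end Literature.RingTheory.KTheory
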